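import Literature.NumberTheory.EllipticCurves.CyclotomicLayerRhoTatePairingPk
import Literature.NumberTheory.GaloisRepresentations.ContinuousShapiroLiftFunctor
import HarnessLib

/-!
# The cofree module `A_ρ = Fᵈ/𝒪ᵈ` of a framed Galois representation as a DISCRETE GALOIS MODULE, the inclusions `A_ρ[N] ↪ A_ρ` as morphisms
# of discrete modules, and the localisation `H¹(Γ_∞, M) → H¹(U_{∞,v}, M|)` at the TOP of a `ℤ_p`-tower (twin of `CyclotomicLayer.layerLocOf`)

Topic `NumberTheory/EllipticCurves`, namespaces `Literature.NumberTheory.EllipticCurves.GreenbergSelmer` (§1–§2) and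
`Literature.NumberTheory.EllipticCurves.CyclotomicLayer` (§3). Lead prover of route `ResidualThetaTransportAtTwo` (cell `bsd-wall`, seat
`bsd-wall-rtt-p2` g18); the generic half of the S₀-side frame of the one-pair road (design note
`Summits/…/Cruxes/ResidualSignedLambdaLowerCMAtTwo/AWAYTWO-FRAME-g18.md` §1). DEFINITIONS WITH BODIES + `rfl`/`simp` lemmas; no named fact, no instance,
no notation; nothing about BSD is claimed.

* §1 `cofreeIntRepresentation S ρ : Representation ℤ Γ_ℚ (Cofree ρ F)` and **`cofreeGaloisModule S ρ : DiscreteGaloisModule ℚ (Cofree ρ F)`** — the FULL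
  divisible module `A_ρ` packaged exactly as its torsion levels `cofreeTorsionGaloisModule S ρ N` are (`GreenbergSelmerCofreeTorsionGaloisModule`:
  `DiscreteGaloisModule.ofIsOpenStabilizer` + `isOpen_stabilizer_cofree`); `discreteTopRep_cofree_eq` (`rfl`): the tree's instance-based
  `discreteTopRep U (Cofree ρ F)` (home of `subgroupH1 U (Cofree ρ F)`, the Selmer sets of RSL_g) IS `subgroupRep (cofreeGaloisModule S ρ).toTopRep U`.
* §2 `cofreeScalar S ρ a` / `cofreeLocalScalar` (multiplication by `a ∈ 𝒪`, an endomorphism of the discrete module — the `𝒪`-structure of `H¹`);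
  **`cofreeTorsionInclusion S ρ N : (cofreeTorsionGaloisModule S ρ N).toTopRep ⟶ (cofreeGaloisModule S ρ).toTopRep`** (`a ↦ ↑a`) and its
  restriction to a local Galois group `cofreeTorsionLocalInclusion` (twins of `cofreeTorsionPow` / `cofreeTorsionLocalPow`, p676533).
* §3 (generic discrete module `M`) `kerGroup κ v := localSubgroupOfEmb κ.kerSubgroup (closureEmb ℚ_v)` = `U_{∞,v} = ⋂_n U_{n,v}`,
  `kerGroup_le_layerGroup`, and **`kerLocOf ρM κ v : H1 ρM κ.kerSubgroup ⟶ H¹(U_{∞,v}, M|)`** — localisation at the top of the tower, the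
  `n = ∞` twin of `layerLocOf ρM κ v n`.

References: R. Greenberg (1989) §1 p. 98; Emerton–Pollack–Weston (2006) §3.1; J.-P. Serre, *Galois Cohomology* I §2.1–2.5, II §1.1;
B. Perrin-Riou (1994) §3.6.1.
-/

noncomputable section

open scoped Classical

open CategoryTheory Field NumberField IsDedekindDomain
open Literature.NumberTheory.GaloisRepresentations

namespace Literature.NumberTheory.EllipticCurves.GreenbergSelmer

/-! ## §1 `A_ρ` as a discrete Galois module -/

section Full

variable {p : ℕ} [Fact p.Prime] (S : Set (PadicAlgCl p)) {n : ℕ} (ρ : FramedGaloisRep ℚ (padicCoeffIntegers S) n)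

/-- **The Galois action on `A_ρ = Fⁿ/𝒪ⁿ` as a `ℤ`-LINEAR representation of `Γ_ℚ`** (the tree's `𝒪`-linear `cofreeRepresentation F ρ`
with scalars restricted to `ℤ`, the input format of `DiscreteGaloisModule.ofIsOpenStabilizer`; twin of `cofreeTorsionRepresentation`).
[cite: Greenberg1989, §1 p. 98] -/
def cofreeIntRepresentation : Representation ℤ (absoluteGaloisGroup ℚ) (Cofree ρ (padicCoeffField S)) where
  toFun σ := (DistribSMul.toAddMonoidHom (Cofree ρ (padicCoeffField S)) σ).toIntLinearMap
  map_one' := by ext a; simp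
  map_mul' σ τ := by ext a; simp [mul_smul]

/-- Unfolding: `cofreeIntRepresentation ρ σ a = σ • a`. [cite: Greenberg1989, §1 p. 98] -/
@[simp]
theorem cofreeIntRepresentation_apply_apply (σ : absoluteGaloisGroup ℚ) (a : Cofree ρ (padicCoeffField S)) :
    cofreeIntRepresentation S ρ σ a = σ • a :=
  rfl

/-- **`A_ρ` as a discrete Galois module over `ℚ`**: stabilisers of points of `Fⁿ/𝒪ⁿ` are open (`isOpen_stabilizer_cofree`:
`ρ(σ) ≡ 1 mod p^k` fixes `v mod 𝒪ⁿ`). Twin of `cofreeTorsionGaloisModule` (the `N`-torsion levels) for the full divisible module.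
[cite: SerreGaloisCohomology1997, I §2.1] [cite: EmertonPollackWeston2006, §3.1 (arXiv:math/0404484 p. 17)] -/
def cofreeGaloisModule : DiscreteGaloisModule ℚ (Cofree ρ (padicCoeffField S)) :=
  DiscreteGaloisModule.ofIsOpenStabilizer (cofreeIntRepresentation S ρ) fun a ↦ by
    have h := isOpen_stabilizer_cofree S ρ a
    convert h using 1
    ext σ
    simp only [Set.mem_setOf_eq, cofreeIntRepresentation_apply_apply, SetLike.mem_coe, MulAction.mem_stabilizer_iff]

/-- Unfolding: `cofreeGaloisModule ρ σ a = σ • a`. [cite: SerreGaloisCohomology1997, I §2.1] -/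
@[simp]
theorem cofreeGaloisModule_apply_apply (σ : absoluteGaloisGroup ℚ) (a : Cofree ρ (padicCoeffField S)) :
    cofreeGaloisModule S ρ σ a = σ • a :=
  rfl

/-- The two cohomology dialects of the tree agree on `A_ρ`: the instance-based `discreteTopRep U (Cofree ρ F)` (whose `H¹` is
`subgroupH1 U (Cofree ρ F)`, home of the Selmer sets) is, definitionally, the restriction to `U` of the `TopRep` of the discrete Galois
module `cofreeGaloisModule S ρ` (whose `H¹` is `H1 (cofreeGaloisModule S ρ) U`). Twin of `discreteTopRep_cofreeTorsionBy_eq`.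
[cite: SerreGaloisCohomology1997, I §2.2] -/
theorem discreteTopRep_cofree_eq (U : Subgroup (absoluteGaloisGroup ℚ)) :
    discreteTopRep U (Cofree ρ (padicCoeffField S)) = subgroupRep (cofreeGaloisModule S ρ).toTopRep U :=
  rfl

/-- `subgroupH1 U (Cofree ρ F) = H1 (cofreeGaloisModule S ρ) U` as types (`rfl`). [cite: SerreGaloisCohomology1997, I §2.2] -/
theorem subgroupH1_cofree_eq (U : Subgroup (absoluteGaloisGroup ℚ)) :
    subgroupH1 U (Cofree ρ (padicCoeffField S)) = H1 (cofreeGaloisModule S ρ) U :=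
  rfl

/-! ## §2 The inclusions `A_ρ[N] ↪ A_ρ` as morphisms of discrete modules -/

variable (N : ℤ)

/-- **`A_ρ[N] ↪ A_ρ`** as a morphism of the discrete `Γ_ℚ`-modules (the subtype inclusion; twin of `cofreeTorsionPow`).
[cite: Kato2004Asterisque, §13.8 (p. 228)] -/
def cofreeTorsionInclusion :
    (cofreeTorsionGaloisModule S ρ N).toTopRep ⟶ (cofreeGaloisModule S ρ).toTopRep :=
  TopRep.ofHom
    { toContinuousLinearMap :=
        { toFun := fun a ↦ (a : Cofree ρ (padicCoeffField S))
          map_add' := fun _ _ ↦ rfl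
          map_smul' := fun _ _ ↦ rfl
          cont := continuous_of_discreteTopology }
      isIntertwining' := fun σ ↦ by
        ext a
        change ((cofreeTorsionGaloisModule S ρ N σ a : ↥(AddSubgroup.torsionBy _ _)) : Cofree ρ (padicCoeffField S)) =
          cofreeGaloisModule S ρ σ (a : Cofree ρ (padicCoeffField S))
        rw [cofreeTorsionGaloisModule_apply_apply, cofreeGaloisModule_apply_apply,
          Literature.NumberTheory.EllipticCurves.AddSubgroup.torsionBy.coe_smul] }

/-- Values of `cofreeTorsionInclusion`: `a ↦ ↑a`. [cite: Kato2004Asterisque, §13.8 (p. 228)] -/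
@[simp] theorem cofreeTorsionInclusion_apply (a : ↥(AddSubgroup.torsionBy (Cofree ρ (padicCoeffField S)) N)) :
    (cofreeTorsionInclusion S ρ N).hom a = (a : Cofree ρ (padicCoeffField S)) := rfl


variable (a : ↥(padicCoeffIntegers S))

/-- **Multiplication by a scalar `a ∈ 𝒪` on `A_ρ`** as an endomorphism of the discrete `Γ_ℚ`-module (`Γ_ℚ` acts `𝒪`-linearly,
`instSMulCommClassCofree`); its effect on `H¹` is the `𝒪`-module structure of the Selmer groups (`GreenbergSelmer.scalarH1` in the
instance dialect). [cite: Greenberg1989, §1 p. 98] -/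
def cofreeScalar : (cofreeGaloisModule S ρ).toTopRep ⟶ (cofreeGaloisModule S ρ).toTopRep :=
  TopRep.ofHom
    { toContinuousLinearMap :=
        { toFun := fun m ↦ a • m
          map_add' := fun x y ↦ smul_add a x y
          map_smul' := fun c x ↦ smul_comm a c x
          cont := continuous_of_discreteTopology }
      isIntertwining' := fun σ ↦ by
        ext m
        change a • cofreeGaloisModule S ρ σ m = cofreeGaloisModule S ρ σ (a • m)
        rw [cofreeGaloisModule_apply_apply, cofreeGaloisModule_apply_apply]
        exact (smul_comm σ a m).symm }

/-- Values of `cofreeScalar`: `m ↦ a • m`. [cite: Greenberg1989, §1 p. 98] -/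
@[simp] theorem cofreeScalar_apply (m : Cofree ρ (padicCoeffField S)) : (cofreeScalar S ρ a).hom m = a • m := rfl

variable (v : HeightOneSpectrum (𝓞 ℚ))

/-- **`A_ρ[N]|_{Γ_v} ↪ A_ρ|_{Γ_v}`** on the local coefficient modules (`CyclotomicLayer.localRepOf`). [cite: Kato2004Asterisque, §13.8 (p. 228)] -/
def cofreeTorsionLocalInclusion :
    CyclotomicLayer.localRepOf (cofreeTorsionGaloisModule S ρ N) v ⟶ CyclotomicLayer.localRepOf (cofreeGaloisModule S ρ) v :=
  TopRep.ofHom ((cofreeTorsionInclusion S ρ N).hom.restrictField (v.adicCompletion ℚ))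

/-- Values of `cofreeTorsionLocalInclusion`. [cite: Kato2004Asterisque, §13.8 (p. 228)] -/
@[simp] theorem cofreeTorsionLocalInclusion_apply (a : ↥(AddSubgroup.torsionBy (Cofree ρ (padicCoeffField S)) N)) :
    (cofreeTorsionLocalInclusion S ρ N v).hom a = (a : Cofree ρ (padicCoeffField S)) := rfl


/-- **Multiplication by `a ∈ 𝒪` on the local coefficient module `A_ρ|_{Γ_v}`.** [cite: Greenberg1989, §1 p. 98] -/
def cofreeLocalScalar : CyclotomicLayer.localRepOf (cofreeGaloisModule S ρ) v ⟶ CyclotomicLayer.localRepOf (cofreeGaloisModule S ρ) v :=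
  TopRep.ofHom ((cofreeScalar S ρ a).hom.restrictField (v.adicCompletion ℚ))

/-- Values of `cofreeLocalScalar`. [cite: Greenberg1989, §1 p. 98] -/
@[simp] theorem cofreeLocalScalar_apply (m : Cofree ρ (padicCoeffField S)) : (cofreeLocalScalar S ρ a v).hom m = a • m := rfl

end Full

end Literature.NumberTheory.EllipticCurves.GreenbergSelmer

/-! ## §3 Localisation at the top of the tower (generic discrete module) -/

namespace Literature.NumberTheory.EllipticCurves.CyclotomicLayer

variable {M : Type} [AddCommGroup M] [TopologicalSpace M] [DiscreteTopology M]
  (ρM : DiscreteGaloisModule ℚ M) {p : ℕ} [Fact p.Prime] (κ : ZpExtension ℚ p) (v : HeightOneSpectrum (𝓞 ℚ))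

/-- `U_{∞,v} = Gal(ℚ̄_v / ℚ_{∞,v})`: the local subgroup of `Γ_∞ = ker κ` for the chosen embedding (`= ⋂_n U_{n,v}`).
[cite: Kobayashi2003, Def. 1.1] [cite: GreenbergLNM1716, §2] -/
abbrev kerGroup : Subgroup (absoluteGaloisGroup (v.adicCompletion ℚ)) :=
  localSubgroupOfEmb κ.kerSubgroup (closureEmb (K := ℚ) (v.adicCompletion ℚ))

/-- `U_{∞,v} ≤ U_{n,v}` for every layer `n` (`Γ_∞ ≤ Γ_n`). [cite: Kobayashi2003, Def. 1.1] -/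
theorem kerGroup_le_layerGroup (n : ℕ) : kerGroup κ v ≤ layerGroup κ v n :=
  Subgroup.comap_mono (κ.kerSubgroup_le_layerSubgroup n)

/-- **Localisation at the top of the tower**: `loc_∞ : H¹(Γ_∞, M) → H¹(U_{∞,v}, M|)`, pull-back along `U_{∞,v} → Γ_∞`
(the `n = ∞` twin of `layerLocOf ρM κ v n`). [cite: Kobayashi2003, (8.23) (p. 18)] [cite: PerrinRiou1994Invent, §3.6.1] -/
def kerLocOf :
    H1 ρM κ.kerSubgroup ⟶ continuousCohomology 1 (subgroupRep (localRepOf ρM v) (kerGroup κ v)) :=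
  ContinuousCohomology.map (resGalSubgroupOfEmb κ.kerSubgroup (closureEmb (K := ℚ) (v.adicCompletion ℚ)))
    (X := subgroupRep ρM.toTopRep κ.kerSubgroup)
    (Y := subgroupRep (localRepOf ρM v) (kerGroup κ v))
    (TopRep.ofHom ⟨ContinuousLinearMap.id ℤ M, fun _ => rfl⟩) 1

end Literature.NumberTheory.EllipticCurves.CyclotomicLayer

end
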